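import Mathlib
import Summits.RiemannHypothesis.RiemannHypothesis.Theorems.HandoffRealZeroCount
import Summits.RiemannHypothesis.RiemannHypothesis.Theorems.HandoffXiZeroCount
import Literature.NumberTheory.LFunctions.RiemannXiProofs
import Literature.NumberTheory.LFunctions.ZetaZeros
import Literature.Analysis.Complex.FourierPolyaKiKimEngine
import Literature.NumberTheory.LFunctions.WeilExplicitFormulaProofs
import Literature.NumberTheory.LFunctions.RHWave0
import HarnessLib

/-!
# ROUTE R-K «COUNT-AND-THIN»: SC-2 ∧ SC-3 ⟹ RH (idea-3 gen22, TASK H-K1) — the theorem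

Handoff track (ROUTE 1′), prove-1 gen13. Source: HOME/handoff/IDEAS-finite-rank.md v3.3.1 PART G22,
§G22-3 (the (B)-type pair SC-2 ∧ SC-3 for the human's question «a conjecture about structure we can
try to prove, which would yield RH») and §G22-4 (ROUTE R-K, hand-off H-K1 to prove-1/2). The named
predicates `CountLaw` / `ThinConvergence` (SC-2 / SC-3 verbatim) live in the statements file
`HandoffCountThinStatements.lean`; THIS file proves the implication with the two hypotheses spelled
out, so that it contains theorems only.

THE OBJECTS. `Ξ = riemannXiUpper` (`Ξ(z) = ξ(1/2 + iz)`; RH ⟺ all zeros of `Ξ` are real,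
`riemannHypothesis_iff_im_eq_zero_of_riemannXiUpper_eq_zero_holds`); `N(T) = zetaZeroCount T`, the
tree's Riemann–von Mangoldt counting function (zeros of `ζ` with `0 < Im ρ ≤ T`, with multiplicity;
`= Σ_{Ξ z = 0, 0 < Re z ≤ T} ord_Ξ(z)` by `sum_analyticOrderNatAt_eq_zetaZeroCount`). A FAMILY
`F : ℝ → ℂ → ℂ`, `t ↦ û_t` — in idea-3's conjectures the cosine transform of the `L²`-normalised
even Weil ground state on `[-t, t]`; HERE an arbitrary family of entire functions, real on `ℝ` and
even, so that the ground state, its existence and its simplicity enter ONLY through the hypotheses: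
* SC-2 (COUNT): `∀ T > 0, ∃ t₀, ∀ t ≥ t₀: #{x ∈ (0, T] : û_t(x) = 0} = N(T)`;
* SC-3 (THIN): `∃ δ ∈ (0, 1/2), ∃ α : ℝ → ℝ, ∀ T > 0: e^{-α_t} û_t → Ξ` uniformly on `[0, T] × [-δ, δ]`.

THE THEOREM `riemannHypothesis_of_count_of_thin` (G22-T): SC-2 ∧ SC-3 ⟹ `RiemannHypothesis`.

PROOF (§G22-3's argument-principle count is replaced by a REAL-variable count — the tree has only
the existence half of Hurwitz's theorem): on `[0, T]` the real functions `x ↦ Re(e^{-α_t} û_t(x))`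
converge to `x ↦ Re Ξ(x)` together with ALL derivatives (Weierstrass on the open complex rectangle
`(-T-1, T+1) × (-δ, δ)`, obtained from SC-3 at `T + 1` by evenness); by the upper semicontinuity of
the real zero count (`RealZeroCount.eventually_ncard_zeros_le`, iterated Rolle) eventually
`#{x ∈ [0,T] : û_t(x) = 0} ≤ Σ_{c real zero of Ξ in (0,T]} ord_Ξ(c)`; SC-2 makes the left side
`≥ N(T) = Σ_{ALL zeros z of Ξ, 0 < Re z ≤ T} ord_Ξ(z)`; so the non-real zeros with `0 < Re z ≤ T`
carry total multiplicity `0`: there are none. `ζ ≠ 0` on the real segment `(0, 1)` excludes zeros of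
`Ξ` on the imaginary axis (`re_ne_zero_of_riemannXiUpper_eq_zero`); evenness handles `Re z < 0`.

RELATION TO THE TREE. `SoloInformedGroundStateLimit.riemannHypothesis_of_tendstoLocallyUniformlyOn`
(Connes's (M1)+(M2) endgame) assumes the approximants have NO NON-REAL ZEROS in the strip
`|Im z| < 1/2` (under (M1) this is Connes–van Suijlekom's theorem) and converge on the WHOLE open
strip; G22-T assumes instead a COUNT of the REAL zeros and convergence on THIN bounded rectangles
only. LOGICAL STATUS (for HANDOFF-STATEMENT / LOGIC-CARD): a pure implication; SC-2 and SC-3 are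
conjectures about the Weil ground states (neither known to follow from RH; both exact, margin-free;
idea-3 §G22-2 reports them on certified data up to `2c - O(15)`); nothing here is, or suggests, a
proof of RH.
-/

set_option linter.dupNamespace false  -- the mandated namespace repeats `RiemannHypothesis`

noncomputable section

open Filter Set Topology Metric Complex
open scoped BigOperators
open Literature.NumberTheory.LFunctions Literature.Analysis.Complex.KiKim

namespace Summit.RiemannHypothesis.RiemannHypothesis.Theorems

namespace CountThin

open RealZeroCount

/-- Symmetrisation: an even family converging to the even `Ξ` uniformly on the thin rectangle
`[0, T+1] × [-δ, δ]` converges locally uniformly on the open symmetric rectangle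
`(-T-1, T+1) × (-δ, δ)`. -/
theorem tendstoLocallyUniformlyOn_symm {Φ : ℝ → ℂ → ℂ} (heven : ∀ t z, Φ t (-z) = Φ t z)
    {T δ : ℝ} (h : TendstoUniformlyOn Φ riemannXiUpper atTop (Icc 0 (T + 1) ×ℂ Icc (-δ) δ)) :
    TendstoLocallyUniformlyOn Φ riemannXiUpper atTop
      (Ioo (-(T + 1)) (T + 1) ×ℂ Ioo (-δ) δ) := by
  set R : Set ℂ := Icc 0 (T + 1) ×ℂ Icc (-δ) δ with hR
  have h' : TendstoUniformlyOn Φ riemannXiUpper atTop ((fun z : ℂ => -z) ⁻¹' R) := by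
    have := h.comp (fun z : ℂ => -z)
    have hΦ : (fun t => Φ t ∘ fun z : ℂ => -z) = Φ := by
      funext t z; simp [heven]
    have hΞ : (riemannXiUpper ∘ fun z : ℂ => -z) = riemannXiUpper := by
      funext z; simp [riemannXiUpper_neg]
    rwa [hΦ, hΞ] at this
  have hU : TendstoUniformlyOn Φ riemannXiUpper atTop (R ∪ (fun z : ℂ => -z) ⁻¹' R) := by
    intro u hu
    filter_upwards [h u hu, h' u hu] with n hn hn' x hx
    exact hx.elim (hn x) (hn' x)
  refine (hU.mono ?_).tendstoLocallyUniformlyOn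
  intro z hz
  rw [mem_reProdIm] at hz
  obtain ⟨⟨hr1, hr2⟩, hi1, hi2⟩ := hz
  rcases le_or_gt 0 z.re with hre | hre
  · exact Or.inl (mem_reProdIm.mpr ⟨⟨hre, hr2.le⟩, hi1.le, hi2.le⟩)
  · refine Or.inr ?_
    show -z ∈ R
    exact mem_reProdIm.mpr ⟨⟨by simp; exact hre.le, by simp; linarith⟩, by simp; linarith, by simp; linarith⟩

/-- The heart of G22-T. Let `t ↦ û_t = F t` be entire, real on `ℝ` and even; assume SC-2 at `T`
(eventually `#{x ∈ (0,T] : û_t(x) = 0} = N(T)`) and SC-3 with constant `δ > 0` and normalisers `α`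
at `T + 1`. Then `Ξ` has no non-real zero with `0 < Re z ≤ T`. -/
theorem im_eq_zero_of_count_of_thin {F : ℝ → ℂ → ℂ} (hdiff : ∀ t, Differentiable ℂ (F t))
    (hreal : ∀ (t : ℝ) (x : ℝ), (F t x).im = 0) (heven : ∀ (t : ℝ) (z : ℂ), F t (-z) = F t z)
    {T δ : ℝ} {α : ℝ → ℝ} (hT0 : 0 < T) (hδ : 0 < δ)
    (hC : ∀ᶠ t : ℝ in atTop,
      {x : ℝ | 0 < x ∧ x ≤ T ∧ F t x = 0}.encard = (zetaZeroCount T : ℕ∞))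
    (hconv : TendstoUniformlyOn (fun t z => ((Real.exp (-α t) : ℝ) : ℂ) * F t z) riemannXiUpper
      atTop (Icc 0 (T + 1) ×ℂ Icc (-δ) δ)) :
    ∀ z : ℂ, riemannXiUpper z = 0 → 0 < z.re → z.re ≤ T → z.im = 0 := by
  classical
  -- the normalised family `Φ t = e^{-α t} û_t`
  set Φ : ℝ → ℂ → ℂ := fun t z => ((Real.exp (-α t) : ℝ) : ℂ) * F t z with hΦ
  have hΦd : ∀ t, Differentiable ℂ (Φ t) := fun t => (differentiable_const _).mul (hdiff t)
  have hΦreal : ∀ (t : ℝ) (x : ℝ), (Φ t x).im = 0 := by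
    intro t x
    show ((((Real.exp (-α t) : ℝ) : ℂ)) * F t x).im = 0
    rw [Complex.im_ofReal_mul, hreal t x, mul_zero]
  have hΦeven : ∀ t z, Φ t (-z) = Φ t z := by intro t z; simp [Φ, heven t z]
  -- convergence on an open neighbourhood of the real segment `[0, T]`
  set U : Set ℂ := Ioo (-(T + 1)) (T + 1) ×ℂ Ioo (-δ) δ with hU
  have hUo : IsOpen U := isOpen_Ioo.reProdIm isOpen_Ioo
  have hloc : TendstoLocallyUniformlyOn Φ riemannXiUpper atTop U :=
    tendstoLocallyUniformlyOn_symm hΦeven hconv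
  have hseg : ∀ x ∈ Icc (0 : ℝ) T, (x : ℂ) ∈ U := by
    intro x hx
    exact mem_reProdIm.mpr ⟨⟨by simp; linarith [hx.1], by simp; linarith [hx.2]⟩,
      by simp [hδ], by simp [hδ]⟩
  -- the data of `RealZeroCount.eventually_ncard_zeros_le`
  set g : ℝ → ℝ := fun x => (riemannXiUpper x).re with hg
  set G : ℝ → ℝ → ℝ := fun t x => (Φ t x).re with hG
  set B := (xiZeros_finite T).toFinset with hB
  set Z : Finset ℝ := (B.filter fun z => z.im = 0).image Complex.re with hZ
  set k : ℝ → ℕ := fun c => analyticOrderNatAt riemannXiUpper (c : ℂ) with hk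
  set N : ℕ := Z.sup k with hN
  have hΞreal := im_riemannXiUpper_ofReal_holds
  have hΞd := differentiable_riemannXiUpper'
  have hgzero : ∀ x ∈ Icc (0 : ℝ) T, g x = 0 → x ∈ Z := by
    intro x hx hgx
    have hΞx : riemannXiUpper x = 0 := Complex.ext (by simpa [g] using hgx) (by simpa using hΞreal x)
    have hx0 : 0 < x := by
      rcases hx.1.eq_or_lt with h | h
      · exact absurd (show (x : ℂ).re = 0 by simp [← h]) (re_ne_zero_of_riemannXiUpper_eq_zero hΞx)
      · exact h
    refine Finset.mem_image.mpr ⟨(x : ℂ), Finset.mem_filter.mpr ⟨?_, by simp⟩, by simp⟩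
    exact (Set.Finite.mem_toFinset _).mpr ⟨hΞx, by simpa using hx0, by simpa using hx.2⟩
  have hev : ∀ᶠ t : ℝ in atTop, {x | x ∈ Icc (0 : ℝ) T ∧ G t x = 0}.Finite ∧
      {x | x ∈ Icc (0 : ℝ) T ∧ G t x = 0}.ncard ≤ ∑ c ∈ Z, k c := by
    refine eventually_ncard_zeros_le (N := N)
      (contDiff_re_ofReal (n := 0) hΞd).continuous
      hgzero ?_ ?_ (fun c hc => Finset.le_sup hc) (Eventually.of_forall fun t => contDiff_re_ofReal (hΦd t))
      ?_ ?_
    · intro c _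
      exact ((contDiff_re_ofReal (n := ⊤) hΞd).continuous_iteratedDeriv
        (k c) (by exact_mod_cast le_top)).continuousAt
    · intro c _
      rw [iteratedDeriv_re_ofReal hΞd]
      have him := im_iteratedDeriv_ofReal_eq_zero hΞd hΞreal (k c) c
      exact fun h => iteratedDeriv_analyticOrderNatAt_ne_zero (c : ℂ)
        (Complex.ext (by simpa using h) (by simpa using him))
    · have := tendstoUniformlyOn_re_iteratedDeriv hUo hΦd hloc hseg 0
      simp only [iteratedDeriv_zero] at this
      exact this
    · intro c _
      have := tendstoUniformlyOn_re_iteratedDeriv hUo hΦd hloc hseg (k c)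
      rw [iteratedDeriv_re_ofReal hΞd]
      refine this.congr (Eventually.of_forall fun t => ?_)
      intro x _
      change (iteratedDeriv (k c) (Φ t) x).re = iteratedDeriv (k c) (fun y : ℝ => (Φ t y).re) x
      rw [iteratedDeriv_re_ofReal (hΦd t)]
  -- a time `t` at which both SC-2 (at `T`) and the zero bound hold
  obtain ⟨t, ⟨hfin, hle⟩, hcount⟩ := (hev.and hC).exists
  -- the real zeros of `û_t` in `(0, T]` are zeros of `G t` in `[0, T]`
  have hsub : {x : ℝ | 0 < x ∧ x ≤ T ∧ F t x = 0} ⊆ {x | x ∈ Icc (0 : ℝ) T ∧ G t x = 0} := by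
    rintro x ⟨hx0, hxT, hFx⟩
    exact ⟨⟨hx0.le, hxT⟩, by simp [G, Φ, hFx]⟩
  have hbound : ∑ z ∈ B, analyticOrderNatAt riemannXiUpper z ≤ ∑ c ∈ Z, k c := by
    have h1 : (zetaZeroCount T : ℕ∞) ≤ ({x | x ∈ Icc (0 : ℝ) T ∧ G t x = 0}.ncard : ℕ∞) := by
      rw [← hcount, hfin.cast_ncard_eq]
      exact Set.encard_le_encard hsub
    rw [hB, sum_analyticOrderNatAt_eq_zetaZeroCount]
    exact (by exact_mod_cast h1 : zetaZeroCount T ≤ _).trans hle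
  -- bookkeeping: the box sum splits into real and non-real zeros; the real part is `∑_{c∈Z} k c`
  have hsplit : ∑ z ∈ B, analyticOrderNatAt riemannXiUpper z
      = ∑ z ∈ B.filter (fun z => z.im = 0), analyticOrderNatAt riemannXiUpper z
        + ∑ z ∈ B.filter (fun z => ¬ z.im = 0), analyticOrderNatAt riemannXiUpper z :=
    (Finset.sum_filter_add_sum_filter_not B _ _).symm
  have hreal_sum : ∑ c ∈ Z, k c
      = ∑ z ∈ B.filter (fun z => z.im = 0), analyticOrderNatAt riemannXiUpper z := by
    rw [hZ, Finset.sum_image]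
    · refine Finset.sum_congr rfl fun z hz => ?_
      have hz0 : z.im = 0 := (Finset.mem_filter.mp hz).2
      simp only [k]
      congr 1
      exact Complex.ext (by simp) (by simp [hz0])
    · intro z hz w hw h
      have hz0 : z.im = 0 := (Finset.mem_filter.mp hz).2
      have hw0 : w.im = 0 := (Finset.mem_filter.mp hw).2
      exact Complex.ext h (by rw [hz0, hw0])
  have hzero_sum : ∑ z ∈ B.filter (fun z => ¬ z.im = 0), analyticOrderNatAt riemannXiUpper z = 0 := by
    have := hbound; rw [hsplit, ← hreal_sum] at this; omega
  intro z hz hz0 hzT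
  by_contra hzim
  have hzB : z ∈ B.filter (fun z => ¬ z.im = 0) :=
    Finset.mem_filter.mpr ⟨(Set.Finite.mem_toFinset _).mpr ⟨hz, hz0, hzT⟩, hzim⟩
  have h1 : 1 ≤ analyticOrderNatAt riemannXiUpper z := one_le_analyticOrderNatAt_of_zero hz
  have := Finset.single_le_sum (fun w _ => Nat.zero_le (analyticOrderNatAt riemannXiUpper w)) hzB
  omega

/-- **THEOREM G22-T** (idea-3 gen22, ROUTE R-K «COUNT-AND-THIN», TASK H-K1; hypotheses spelled out —
the named form `CountLaw F → ThinConvergence F → RiemannHypothesis` is in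
`HandoffCountThinStatements`). For any family `t ↦ û_t` of entire functions that are real on `ℝ`
and even (as the cosine transforms of the real even Weil ground states are):
SC-2 (for every `T > 0`, eventually `#{x ∈ (0, T] : û_t(x) = 0} = N(T)`) and SC-3 (for some
`δ ∈ (0, 1/2)` and normalisers `α_t`, `e^{-α_t} û_t → Ξ` uniformly on every thin rectangle
`[0, T] × [-δ, δ]`) together imply the Riemann Hypothesis. A pure implication — SC-2 and SC-3 are
open conjectures about the Weil ground states; nothing here is, or suggests, a proof of RH. -/
theorem riemannHypothesis_of_count_of_thin {F : ℝ → ℂ → ℂ}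
    (hdiff : ∀ t, Differentiable ℂ (F t)) (hreal : ∀ (t : ℝ) (x : ℝ), (F t x).im = 0)
    (heven : ∀ (t : ℝ) (z : ℂ), F t (-z) = F t z)
    (hC : ∀ T : ℝ, 0 < T → ∀ᶠ t : ℝ in atTop,
      {x : ℝ | 0 < x ∧ x ≤ T ∧ F t x = 0}.encard = (zetaZeroCount T : ℕ∞))
    (hT : ∃ δ : ℝ, 0 < δ ∧ δ < 1 / 2 ∧ ∃ α : ℝ → ℝ, ∀ T : ℝ, 0 < T →
      TendstoUniformlyOn (fun t z => ((Real.exp (-α t) : ℝ) : ℂ) * F t z) riemannXiUpper atTop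
        (Icc 0 T ×ℂ Icc (-δ) δ)) :
    RiemannHypothesis := by
  obtain ⟨δ, hδ, -, α, hconv⟩ := hT
  have key : ∀ T : ℝ, 0 < T → ∀ z : ℂ, riemannXiUpper z = 0 → 0 < z.re → z.re ≤ T → z.im = 0 :=
    fun T hT0 => im_eq_zero_of_count_of_thin hdiff hreal heven hT0 hδ (hC T hT0)
      (hconv (T + 1) (by linarith))
  refine (riemannHypothesis_iff_im_eq_zero_of_riemannXiUpper_eq_zero_holds :
    RiemannHypothesis ↔ _).mpr fun z hz => ?_
  rcases lt_trichotomy z.re 0 with hre | hre | hre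
  · have hz' : riemannXiUpper (-z) = 0 := by rw [riemannXiUpper_neg]; exact hz
    have := key ((-z).re) (by simp; linarith) (-z) hz' (by simp; linarith) le_rfl
    simpa using this
  · exact absurd hre (re_ne_zero_of_riemannXiUpper_eq_zero hz)
  · exact key z.re hre z hz hre le_rfl


/-! ## Sharpness: the constant family `û_t := Ξ` -/

/-- Under RH, every zero of `Ξ` is real. -/
theorem im_eq_zero_of_riemannHypothesis (hRH : RiemannHypothesis) {z : ℂ} (hz : riemannXiUpper z = 0) :
    z.im = 0 :=
  ((riemannHypothesis_iff_im_eq_zero_of_riemannXiUpper_eq_zero_holds : RiemannHypothesis ↔ _).mp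
    hRH) z hz

/-- Under the simple-zeros conjecture, every zero of `Ξ` has analytic order `1`. -/
theorem analyticOrderNatAt_eq_one_of_simple (hS : SimpleZerosConjecture) {z : ℂ}
    (hz : riemannXiUpper z = 0) : analyticOrderNatAt riemannXiUpper z = 1 := by
  obtain ⟨hζ, h0, h1⟩ := zeta_zero_of_riemannXiUpper_eq_zero hz
  set ρ := 1 / 2 + I * z with hρ
  have hρ1 : ρ ≠ 1 := fun h => by rw [h] at h1; simp at h1
  have hmem : ρ ∈ ZetaZeros.riemannZetaNontrivialZeros :=
    mem_riemannZetaNontrivialZeros_of_riemannXi_eq_zero hz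
  have hder : deriv riemannZeta ρ ≠ 0 := hS ρ hmem
  have hord : analyticOrderAt riemannZeta ρ = 1 :=
    (analyticOn_riemannZeta ρ hρ1).analyticOrderAt_eq_one_of_zero_deriv_ne_zero hζ hder
  have hm : riemannZetaZeroOrder ρ = 1 := by
    rw [riemannZetaZeroOrder, (analyticOn_riemannZeta ρ hρ1).meromorphicOrderAt_eq, hord]
    simp
  have := analyticOrderNatAt_riemannXiUpper_eq h0 h1
  rw [hm] at this
  exact_mod_cast this

/-- **SHARPNESS of G22-T.** Under RH and the simplicity of the zeros of `ζ`, the CONSTANT family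
`û_t := Ξ` satisfies SC-2: `#{x ∈ (0, T] : Ξ(x) = 0} = N(T)` for every `T` (SC-3 being trivial for
it). So the existential form «some admissible family satisfies SC-2 ∧ SC-3» lies between `RH` and
`RH ∧ SimpleZerosConjecture`. -/
theorem encard_real_zeros_xi_eq_zetaZeroCount (hRH : RiemannHypothesis) (hS : SimpleZerosConjecture)
    (T : ℝ) : {x : ℝ | 0 < x ∧ x ≤ T ∧ riemannXiUpper x = 0}.encard = (zetaZeroCount T : ℕ∞) := by
  classical
  set S : Set ℝ := {x : ℝ | 0 < x ∧ x ≤ T ∧ riemannXiUpper x = 0} with hS'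
  set box : Set ℂ := {z : ℂ | riemannXiUpper z = 0 ∧ 0 < z.re ∧ z.re ≤ T} with hbox
  -- under RH the box consists of real points: it is the image of `S`
  have himg : ((↑) : ℝ → ℂ) '' S = box := by
    ext z
    constructor
    · rintro ⟨x, ⟨hx0, hxT, hx⟩, rfl⟩
      exact ⟨hx, by simpa using hx0, by simpa using hxT⟩
    · rintro ⟨hz, hz0, hzT⟩
      have hzim : z.im = 0 := im_eq_zero_of_riemannHypothesis hRH hz
      have hzre : ((z.re : ℝ) : ℂ) = z := Complex.ext (by simp) (by simp [hzim])
      exact ⟨z.re, ⟨hz0, hzT, by rw [hzre]; exact hz⟩, hzre⟩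
  have hfin := xiZeros_finite T
  have hsum : ∑ z ∈ hfin.toFinset, analyticOrderNatAt riemannXiUpper z = hfin.toFinset.card := by
    rw [Finset.card_eq_sum_ones]
    refine Finset.sum_congr rfl fun z hz => ?_
    exact analyticOrderNatAt_eq_one_of_simple hS ((Set.Finite.mem_toFinset _).mp hz).1
  rw [← Complex.ofReal_injective.encard_image S, himg, hfin.encard_eq_coe_toFinset_card,
    ← sum_analyticOrderNatAt_eq_zetaZeroCount T, hsum]

/-- SC-3 for the constant family `û_t := Ξ` (with `α = 0`): trivial. -/
theorem tendstoUniformlyOn_const_xi (s : Set ℂ) :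
    TendstoUniformlyOn (fun (_ : ℝ) z => ((Real.exp (-(0 : ℝ)) : ℝ) : ℂ) * riemannXiUpper z)
      riemannXiUpper atTop s := by
  have : (fun (_ : ℝ) z => ((Real.exp (-(0 : ℝ)) : ℝ) : ℂ) * riemannXiUpper z) =
      fun _ => riemannXiUpper := by
    funext t z; simp
  rw [this]
  intro u hu
  exact Eventually.of_forall fun _ x _ => refl_mem_uniformity hu

/-! Axiom census (expected `propext`, `Classical.choice`, `Quot.sound`). -/
#print axioms riemannHypothesis_of_count_of_thin

end CountThin

end Summit.RiemannHypothesis.RiemannHypothesis.Theorems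

end
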